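import Literature.LinearAlgebra.Alternating.DerivationExtension
import Literature.LinearAlgebra.Alternating.ExteriorAlgebraSpinorRepresentation
import HarnessLib

/-!
# Looijenga–Lunts' degree-zero derivation extension `σ̃` on `⋀^• V^* ⊗ ℂ` is Verbitsky's `ad(σ^*)`
# (Looijenga–Lunts 1997 §3 (3.1)–(3.2) against Verbitsky 1996 §1)

Topic `Literature/LinearAlgebra/Alternating`, namespace `Literature.LinearAlgebra.Alternating`. Lane `lit-hodgefound`
(Track 2 foundations library), prover seat p06 (generation 14), self-proposed row g14-#2: the junction of row
A1-43 FILE 1 (`ExteriorAlgebraSpinorRepresentation.lean`: the spinor representation of `𝔰𝔬(V ⊕ V^*)` on the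
graded forms `GForm V ℂ = ⋀^• V^* ⊗ ℂ` of a torus, with the derivation extension `derivExt V σ = σ̃` of
`σ ∈ 𝔤𝔩(V^*)` given by the basis formula `∑ᵢ e_{σθⁱ} i_{vᵢ}`) with row g14-#1 FILE 1 (`DerivationExtension.lean`:
Verbitsky's `ad T` on one `E [⋀^Fin k]→L[ℝ] W`, `adAlt T`, the derivative of the pull-back action).

## Sources, verbatim

* E. Looijenga, V. A. Lunts, *A Lie algebra attached to a projective variety*, Invent. Math. 129 (1997)
  361–412 = alg-geom/9604014, §3 [held `paper:arxiv-alg-geom_9604014` p0013 L32–L73]: "… write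
  `σ̃(a∧b, α∧β)` for its extension as a degree zero derivation in `⋀^• V^*` …"; "`ψ₀ : 𝔤𝔩(V^*) → 𝔰𝔬(V ⊕ V^*)₀;
  ψ₀(σ)(x, ξ) = (−σ^*(x), σ(ξ))`"; **(3.2) Proposition**: "The maps `ψ₂(α∧β) ↦ e_α e_β`,
  `ψ₋₂(a∧b) ↦ i_a i_b` extend to a graded Lie algebra isomorphism of `𝔰𝔬(V ⊕ V^*)` onto `𝔤` that maps
  `ψ₀(σ)` to `σ̃ − ½ Tr(σ) 1_{⋀^• V^*}`, where `σ̃` denotes the extension of `σ` as a degree zero derivation of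
  `⋀^• V^*`."
* M. Verbitsky, J. Alg. Geom. 5 (1996) = alg-geom/9307008, §1 [held `paper:arxiv-alg-geom_9307008` p0001
  L108–L114]: "Define `ad I`. Let this operator act as a complex structure operator `I` on the bundle of
  differential 1-forms. We extend it on `i`-forms for arbitrary `i` using Leibnitz formula".

## What is formalised (theorems only; no definition, no named fact, no `sorry`)

§1 (any real normed `E`, `W`): **`adAlt_eq_alternatizeUncurryFin`** — `ad T f = A(v ↦ (T v) ⌟ f)` for Mathlib's
alternatization `alternatizeUncurryFin` (the operation underlying `extDeriv`): `(ad T f)(u₀, …, uₙ) =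
∑ⱼ (−1)ʲ f(T uⱼ, u₀, …, ûⱼ, …, uₙ)`; **`sum_wedgeOne_comp_curryLeft`** — the generalised Euler identity
`∑ᵢ (θᵢ ∘ T) ∧ (vᵢ ⌟ f) = ad T f` for any dual pair `∑ᵢ θᵢ ⊗ vᵢ = id` (the tree's `sum_wedgeOne_curryLeft` is
`T = id`: `∑ᵢ θᵢ ∧ (vᵢ ⌟ f) = (n+1) f`) — the basis formula `σ̃ = ∑ᵢ e_{σθⁱ} i_{vᵢ}` read on one form;
**`curryLeft_adAlt`** — `v ⌟ (ad T η) = (T v) ⌟ η + ad T (v ⌟ η)`, i.e. `[i_v, ad T] = i_{Tv}`.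
§2 (`V` finite-dimensional, on `GForm V ℂ`): `apply_eq_comp_dualTranspose` (`σ ξ = ξ ∘ σ^*`);
**`derivExt_apply_apply`** — `(σ̃ w)_m = ad(σ^*) w_m` for EVERY `σ ∈ 𝔤𝔩(V^*)` and every graded form `w`
(so A1-43's `σ̃` and Verbitsky's `ad` are one operator); `derivExt_of`; for `σ_T = (θ ↦ θ ∘ T)`
(`ContinuousLinearMap.precomp ℝ T`): `dualTranspose_precomp` (`σ_T^* = T`), `derivExt_precomp_apply`,
`derivExt_precomp_of` (`σ̃_T (of k η) = of k (ad T η)`); the derivation property against the Clifford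
generators: **`derivExt_mul_extR`** (`σ̃ e_α = e_{σα} + e_α σ̃`, the identity announced in `derivExt`'s docstring)
and **`intC_mul_derivExt`** (`i_v σ̃ = i_{σ^* v} + σ̃ i_v`) — together `[ρ(ψ₀σ), γ(z)] = γ(ψ₀σ z)` on the
generators; `trace_precomp` (`Tr σ_T = Tr T`) and **`spinorRepLin_psi0_precomp_of`**: (3.2) on `k`-forms,
`ρ(ψ₀ σ_T)(of k η) = of k (ad T η − ½ Tr(T) η)` — the `𝔤𝔩(V)`-part of the total Lie algebra of a torus acts on
`H^k = ⋀^k H¹` by Verbitsky's derivation action shifted by half the trace.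

SCOPE NOTE. Nothing here is specific to complex structures; for a complex torus `X = E/Λ` and `T = I, J, K` of
a hyperkähler structure these are the operators of Verbitsky's `𝔰𝔲(2)` inside Looijenga–Lunts' `𝔤_tot(X)`
(up to the central shift `½ Tr`, which vanishes for the traceless `I, J, K`); that identification of Lie
subalgebras is not recorded here.

## References

* [LooijengaLunts1997] E. Looijenga, V. A. Lunts, *A Lie algebra attached to a projective variety*, Invent.
  Math. 129 (1997), 361–412, §3 (3.1)–(3.2).
* [Verbitsky1996Hyperholomorphic] M. Verbitsky, *Hyperholomorphic bundles over a hyperkähler manifold*,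
  J. Alg. Geom. 5 (1996) 633–669 = alg-geom/9307008, §1 (definition of `ad I`).
* [Lang2002] S. Lang, *Algebra*, 3rd ed., GTM 211 (2002), XIII §3 (trace, transpose), III §6 (dual basis).
* [Warner1983] F. W. Warner, *Foundations of Differentiable Manifolds and Lie Groups* (1983), 2.10–2.11.
-/

noncomputable section

open Function Finset ContinuousAlternatingMap

namespace Literature.LinearAlgebra.Alternating

section General

variable {E W : Type*} [NormedAddCommGroup E] [NormedSpace ℝ E] [NormedAddCommGroup W] [NormedSpace ℝ W]
  {n : ℕ}

/-- Inserting `x` at slot `j` into the tuple with slot `j` removed is updating slot `j`. [folklore] -/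
private theorem insertNth_removeNth_eq_update {X : Type*} (j : Fin (n + 1)) (x : X) (u : Fin (n + 1) → X) :
    j.insertNth x (j.removeNth u) = update u j x := by
  rw [Fin.insertNth_eq_iff]
  refine ⟨(update_self j x u).symm, ?_⟩
  funext i
  exact (update_of_ne (Fin.succAbove_ne j i) x u).symm

/-- **`ad T` is the alternatization of `v ↦ (T v) ⌟ f`**: `ad T f = A(v ↦ T v ⌟ f)`, i.e.
`(ad T f)(u₀, …, uₙ) = ∑ⱼ (−1)ʲ f(T uⱼ, u₀, …, ûⱼ, …, uₙ)` (Mathlib's `alternatizeUncurryFin`, the operation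
underlying `extDeriv`; this is `fderivCompContinuousLinearMap_eq_alternatizeUncurryFin` at `g = id`). With
`v ↦ v ⌟ f` in place of `v ↦ T v ⌟ f` it is Euler's identity `A(v ↦ v ⌟ f) = (n+1) f` (`ad 1 = deg`).
[cite: LooijengaLunts1997, §3 (3.2) ("σ̃ denotes the extension of σ as a degree zero derivation")] -/
theorem adAlt_eq_alternatizeUncurryFin (T : E →L[ℝ] E) (f : E [⋀^Fin (n + 1)]→L[ℝ] W) :
    adAlt T f = alternatizeUncurryFin (f.curryLeft.comp T) := by
  ext u
  rw [adAlt_apply, alternatizeUncurryFin_apply]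
  refine Finset.sum_congr rfl fun j _ ↦ ?_
  rw [ContinuousLinearMap.comp_apply, curryLeft_apply_apply, ← map_insertNth, insertNth_removeNth_eq_update]

/-- **Generalised Euler identity**: for a dual pair `(θᵢ, vᵢ)` (`∑ᵢ θᵢ ⊗ vᵢ = id`) and any continuous
endomorphism `T`, `∑ᵢ (θᵢ ∘ T) ∧ (vᵢ ⌟ f) = ad T f` — the basis formula `σ̃ = ∑ᵢ e_{σθⁱ} i_{vᵢ}` of the
derivation extension (`derivExt_eq_sum`) read on one `(n+1)`-form, for `σ = (θ ↦ θ ∘ T)`; `T = id` is the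
tree's `sum_wedgeOne_curryLeft`. [cite: LooijengaLunts1997, §3 (3.2)] -/
theorem sum_wedgeOne_comp_curryLeft {ι' : Type*} [Fintype ι'] (θ₀ : ι' → (E →L[ℝ] ℝ)) (v : ι' → E)
    (h : ∑ i, (θ₀ i).smulRight (v i) = ContinuousLinearMap.id ℝ E) (T : E →L[ℝ] E)
    (f : E [⋀^Fin (n + 1)]→L[ℝ] W) :
    ∑ i, wedgeOne ((θ₀ i).comp T) (f.curryLeft (v i)) = adAlt T f := by
  have h' : ∀ w, ∑ i, θ₀ i w • v i = w := fun w ↦ by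
    simpa using congrArg (fun S : E →L[ℝ] E ↦ S w) h
  have key : ∑ i, ((θ₀ i).comp T).smulRight (f.curryLeft (v i)) = f.curryLeft.comp T := by
    ext w u
    have hw := congrArg (fun x ↦ f.curryLeft x u) (h' (T w))
    simp only [_root_.map_sum, map_smul] at hw
    simpa using hw
  calc ∑ i, wedgeOne ((θ₀ i).comp T) (f.curryLeft (v i))
      = ∑ i, alternatizeUncurryFinCLM ℝ E W (((θ₀ i).comp T).smulRight (f.curryLeft (v i))) := by
        simp only [alternatizeUncurryFinCLM_apply]; rfl
    _ = alternatizeUncurryFin (f.curryLeft.comp T) := by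
        rw [← _root_.map_sum, key, alternatizeUncurryFinCLM_apply]
    _ = adAlt T f := (adAlt_eq_alternatizeUncurryFin T f).symm

/-- **The interior product intertwines `ad`**: `v ⌟ (ad T η) = (T v) ⌟ η + ad T (v ⌟ η)`, i.e.
`[i_v, ad T] = i_{Tv}` — the annihilation operators transform under `σ̃` by the dual action (`ψ₀(σ) = (−σ^*, σ)`
on `V ⊕ V^*`; with FILE 1's `adAlt_wedgeOne`, `[ad T, e_θ] = e_{θ∘T}`, these are the two halves of
`[ρ(T), γ(z)] = γ(Tz)`). [cite: LooijengaLunts1997, §3 (3.1)–(3.2)] -/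
theorem curryLeft_adAlt (T : E →L[ℝ] E) (η : E [⋀^Fin (n + 1)]→L[ℝ] W) (v : E) :
    (adAlt T η).curryLeft v = η.curryLeft (T v) + adAlt T (η.curryLeft v) := by
  ext u
  simp only [curryLeft_apply_apply, ContinuousAlternatingMap.add_apply, adAlt_apply, Fin.sum_univ_succ,
    Matrix.cons_val_zero, Matrix.cons_val_succ]
  congr 1
  · rw [show update (Matrix.vecCons v u) 0 (T v) = Matrix.vecCons (T v) u from Fin.update_cons_zero _ _ _]
  · refine Finset.sum_congr rfl fun i _ ↦ ?_
    rw [show update (Matrix.vecCons v u) i.succ (T (u i)) = Matrix.vecCons v (update u i (T (u i))) from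
      (Fin.cons_update _ _ _ _).symm]

end General

/-! ## On the graded forms `GForm V ℂ = ⋀^• V^* ⊗ ℂ` of a finite-dimensional `V` -/

section Graded

open GForm (extR intC of extR_of intC_of_succ intC_of_zero of_zero of_sum extR_apply_succ extR_apply_zero
  intC_apply of_apply_self of_apply_of_ne)

variable (V : Type*) [NormedAddCommGroup V] [NormedSpace ℝ V] [FiniteDimensional ℝ V]

/-- `σ ∈ 𝔤𝔩(V^*)` is precomposition with its transpose: `σ ξ = ξ ∘ σ^*` (`apply_dualTranspose`, with `σ^*`
upgraded to a continuous linear map of the finite-dimensional `V`). [cite: LooijengaLunts1997, §3 (3.1)] -/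
theorem apply_eq_comp_dualTranspose (σ : Module.End ℝ (V →L[ℝ] ℝ)) (ξ : V →L[ℝ] ℝ) :
    σ ξ = ξ.comp (LinearMap.toContinuousLinearMap (dualTranspose V σ)) := by
  ext x
  rw [ContinuousLinearMap.comp_apply, LinearMap.coe_toContinuousLinearMap', apply_dualTranspose]

/-- **Looijenga–Lunts' derivation extension `σ̃` is Verbitsky's `ad (σ^*)` in every degree**:
`(σ̃ w)_m = ad(σ^*) w_m` for every graded form `w ∈ ⋀^• V^* ⊗ ℂ` (`derivExt` of
`ExteriorAlgebraSpinorRepresentation.lean`, row A1-43, versus `adAlt` of `DerivationExtension.lean`).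
[cite: LooijengaLunts1997, §3 (3.2)] [cite: Verbitsky1996Hyperholomorphic, §1 (definition of ad I)] -/
theorem derivExt_apply_apply (σ : Module.End ℝ (V →L[ℝ] ℝ)) (w : GForm V ℂ) (m : ℕ) :
    derivExt V σ w m = adAlt (LinearMap.toContinuousLinearMap (dualTranspose V σ)) (w m) := by
  rw [derivExt_apply, LinearMap.sum_apply, Finset.sum_apply]
  cases m with
  | zero =>
    simp only [Module.End.mul_apply, extR_apply_zero, Finset.sum_const_zero, adAlt_of_degree_zero]
  | succ m =>
    simp only [Module.End.mul_apply, extR_apply_succ, intC_apply, apply_eq_comp_dualTranspose V σ]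
    exact sum_wedgeOne_comp_curryLeft (coordCLM V (Module.finBasis ℝ V)) (Module.finBasis ℝ V)
      (sum_coordCLM_smulRight V (Module.finBasis ℝ V)) _ (w (m + 1))

/-- On homogeneous elements: `σ̃ (of k η) = of k (ad(σ^*) η)`. [cite: LooijengaLunts1997, §3 (3.2)] -/
theorem derivExt_of (σ : Module.End ℝ (V →L[ℝ] ℝ)) (k : ℕ) (η : V [⋀^Fin k]→L[ℝ] ℂ) :
    derivExt V σ (of k η) = of k (adAlt (LinearMap.toContinuousLinearMap (dualTranspose V σ)) η) := by
  funext m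
  rw [derivExt_apply_apply]
  rcases eq_or_ne m k with rfl | h
  · rw [of_apply_self, of_apply_self]
  · rw [of_apply_of_ne h, of_apply_of_ne h, _root_.map_zero]

/-- The transpose of `σ_T = (θ ↦ θ ∘ T)` is `T`. [cite: Lang2002, XIII §3] -/
theorem dualTranspose_precomp (T : V →L[ℝ] V) :
    LinearMap.toContinuousLinearMap
        (dualTranspose V (ContinuousLinearMap.precomp ℝ T : (V →L[ℝ] ℝ) →L[ℝ] (V →L[ℝ] ℝ))) = T := by
  ext x
  rw [← sub_eq_zero]
  refine eq_zero_of_forall_apply_eq_zero V fun ξ ↦ ?_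
  rw [map_sub, LinearMap.coe_toContinuousLinearMap', apply_dualTranspose, ContinuousLinearMap.coe_coe,
    ContinuousLinearMap.precomp_apply, ContinuousLinearMap.comp_apply, sub_self]

/-- **For `σ_T = (θ ↦ θ ∘ T)`: `(σ̃_T w)_m = ad T w_m`.** [cite: LooijengaLunts1997, §3 (3.2)]
[cite: Verbitsky1996Hyperholomorphic, §1 (definition of ad I)] -/
theorem derivExt_precomp_apply (T : V →L[ℝ] V) (w : GForm V ℂ) (m : ℕ) :
    derivExt V (ContinuousLinearMap.precomp ℝ T : (V →L[ℝ] ℝ) →L[ℝ] (V →L[ℝ] ℝ)) w m = adAlt T (w m) := by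
  rw [derivExt_apply_apply, dualTranspose_precomp]

/-- `σ̃_T (of k η) = of k (ad T η)`. [cite: LooijengaLunts1997, §3 (3.2)] -/
theorem derivExt_precomp_of (T : V →L[ℝ] V) (k : ℕ) (η : V [⋀^Fin k]→L[ℝ] ℂ) :
    derivExt V (ContinuousLinearMap.precomp ℝ T : (V →L[ℝ] ℝ) →L[ℝ] (V →L[ℝ] ℝ)) (of k η) =
      of k (adAlt T η) := by
  rw [derivExt_of, dualTranspose_precomp]

/-- **`[σ̃, e_α] = e_{σα}`: `σ̃` is a derivation for the creation operators** (`derivExt_mul_extR`, announced in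
the docstring of `derivExt`; FILE 1's `adAlt_wedgeOne` degreewise). [cite: LooijengaLunts1997, §3 (3.2)] -/
theorem derivExt_mul_extR (σ : Module.End ℝ (V →L[ℝ] ℝ)) (α : V →L[ℝ] ℝ) :
    derivExt V σ * extR α = extR (σ α) + extR α * derivExt V σ := by
  refine LinearMap.ext fun w ↦ funext fun m ↦ ?_
  cases m with
  | zero =>
    rw [Module.End.mul_apply, derivExt_apply_apply, LinearMap.add_apply, Module.End.mul_apply]
    simp only [extR_apply_zero, _root_.map_zero, Pi.add_apply, add_zero]
  | succ m =>
    rw [Module.End.mul_apply, derivExt_apply_apply, LinearMap.add_apply, Module.End.mul_apply, Pi.add_apply,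
      extR_apply_succ, extR_apply_succ, extR_apply_succ, derivExt_apply_apply, adAlt_wedgeOne,
      apply_eq_comp_dualTranspose V σ α]

/-- **`[i_v, σ̃] = i_{σ^* v}`: the annihilation operators transform by the transpose** (`curryLeft_adAlt`
degreewise; with `derivExt_mul_extR` the two halves of `[ρ(ψ₀σ), γ(z)] = γ(ψ₀σ z)`).
[cite: LooijengaLunts1997, §3 (3.1)–(3.2)] -/
theorem intC_mul_derivExt (σ : Module.End ℝ (V →L[ℝ] ℝ)) (v : V) :
    intC v * derivExt V σ = intC (dualTranspose V σ v) + derivExt V σ * intC v := by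
  refine LinearMap.ext fun w ↦ funext fun m ↦ ?_
  rw [Module.End.mul_apply, LinearMap.add_apply, Module.End.mul_apply, Pi.add_apply, intC_apply, intC_apply,
    derivExt_apply_apply, derivExt_apply_apply, intC_apply, curryLeft_adAlt, LinearMap.coe_toContinuousLinearMap']

/-- The trace of `θ ↦ θ ∘ T` on `V^*` is the trace of `T`. [cite: Lang2002, XIII §3] -/
theorem trace_precomp (T : V →L[ℝ] V) :
    LinearMap.trace ℝ (V →L[ℝ] ℝ) (ContinuousLinearMap.precomp ℝ T : (V →L[ℝ] ℝ) →L[ℝ] (V →L[ℝ] ℝ)) =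
      LinearMap.trace ℝ V (T : V →ₗ[ℝ] V) := by
  classical
  rw [trace_eq_sum_apply V (Module.finBasis ℝ V), LinearMap.trace_eq_matrix_trace ℝ (Module.finBasis ℝ V),
    Matrix.trace]
  simp only [ContinuousLinearMap.coe_coe, ContinuousLinearMap.precomp_apply, ContinuousLinearMap.comp_apply,
    coordCLM_apply, Matrix.diag_apply, LinearMap.toMatrix_apply]

/-- **Looijenga–Lunts (3.2) for `σ_T = (θ ↦ θ ∘ T)`, on `k`-forms**: the spinor representation of
`ψ₀(σ_T) ∈ 𝔰𝔬(V ⊕ V^*)₀` acts on `⋀^k V^* ⊗ ℂ` by `ad T − ½ Tr(T)` ("maps `ψ₀(σ)` to `σ̃ − ½ Tr(σ) 1`"): the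
`𝔤𝔩(V)`-part of the total Lie algebra of a torus acts on `H^k = ⋀^k H¹` by Verbitsky's derivation action,
shifted by half the trace. [cite: LooijengaLunts1997, §3 (3.2)] -/
theorem spinorRepLin_psi0_precomp_of (T : V →L[ℝ] V) (k : ℕ) (η : V [⋀^Fin k]→L[ℝ] ℂ) :
    spinorRepLin V (psi0 V (ContinuousLinearMap.precomp ℝ T : (V →L[ℝ] ℝ) →L[ℝ] (V →L[ℝ] ℝ))) (of k η) =
      of k (adAlt T η - ((1 / 2 : ℝ) * LinearMap.trace ℝ V (T : V →ₗ[ℝ] V)) • η) := by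
  rw [spinorRepLin_psi0, LinearMap.sub_apply, derivExt_precomp_of, trace_precomp, LinearMap.smul_apply,
    Module.End.one_apply, GForm.of_sub, GForm.of_smul]

end Graded

end Literature.LinearAlgebra.Alternating

end
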